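import Summits.QuantumFields.BalabanUV.T4Continuum.Support.NE7ApeCurvedRepRoadBBalabanScalarEnd
import Summits.QuantumFields.BalabanUV.T4Continuum.Support.NE7SmoothRightInverseBmeanIterW
import Summits.QuantumFields.BalabanUV.T4Continuum.Spine.NE3.LandauProjectionB8
import HarnessLib

/-!
# NE7ApeCurvedRepRoadBBalabanScalarT1End — PACKAGE B's END WITH (T1) DISCHARGED: F171 `NE7ApeCurvedRepRoadBBalabanScalarEnd` (curved (APE) ⇐ … + (KL-B)[any `Gauge`] + (T1) +
# (T2)) with its smooth-right-inverse letter (T1) SUPPLIED by F187's squared-tent nested fix (`C_a = 2·64^d`, `C_a′ = K_Δ(2g_W)·2·64^d`): package B now rests on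
# (KL-B)[Gauge] + (T2) only (file 120 of the curved (APE), F190)

Cell `pub-balaban`, rung (B)+1 sub-cell t4, lineage `b2b-balaban-t4-ne7-p1` (CRUX PROVER NE7 #1 = OWNER of row NE7), generation 84; memo `t4/b2b-balaban-t4-ne7-p1-g84/SCALAR-ROWS.md` §3.
Over F171 and F187 `NE7SmoothRightInverseBmeanIterW.smoothRightInverse_letter_of_fluxGrad` BY NAME (`covDiv_W ∘ D_W = Δ_W`: row NE3's `covDiv_gaugeDir_eq_covLapSite`).
WHAT ([folklore]; 0 def, 0 sorry).  **`smallField_of_tanCritical_roadB_balaban_scalar_T1_end`** — F171 with the binder `hT1` replaced by the defining equations of its two constants.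
HONEST FRAMING (page 1): composition; (KL-B)[Gauge] and (T2) (the block-Landau correction's size for the chosen `Gauge`) remain HYPOTHESIS SHAPES; package A (F188, `Gauge :=
IsLandauB8`, (T2) = (R-C8) discharged by F180) is the END of record; nothing of Bałaban's asserted; (APE) on curved data NOT proved; NOT ONE-STEP, NOT NE7; spine 0∕9; finite T⁴
rung (B)+1 — NOT infinite volume, NOT mass gap, NOT `BetaPertH`, NOT Clay.  Continuum YM on T⁴ ⇐ BetaPertH ∧ nine spine estimates (0/9 proved); BetaPertH ⇐ (D1) ∧ (D4) ∧
CAP+tail; G-an2-4 gates asym, D1 and NE2/3/4.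
-/

set_option autoImplicit false

open scoped BigOperators Matrix Matrix.Norms.L2Operator
open NormedSpace Finset

namespace Summit.QuantumFields.BalabanUV.T4Continuum.NE7ApeCurvedRepRoadBBalabanScalarT1End

open Literature.MathematicalPhysics.QuantumFieldTheory.Balaban1983to89
open B7Prop1Explicit B7Prop2Explicit MatrixLog UnitaryModel
open T4AveragingDeficitWall (Ad IsUnitaryCfg IsSkewDir SmallField vary curlAt dirL1 flux covGrad)
open T4AveragingDeficitWallBoundary (IsPeriodicCfg periodBox)
open AveragingDeficitPeriodicCounting (IsPeriodicDir)
open AveragingDeficitTwoLevelPrep (twoLevelSmall)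
open AveragingDeficitMultiLevelPrep (cavgIter LevelSmall)
open MinimalActionLevels (perWin)
open BlockAverageVaryHolo (nbRad)
open BlockAveragePushDirGauge (gaugeDir)
open NE3HessForm (hess dAction)
open NE3TangentCovariantTower (dirIter QbarIter)
open NE3EnergyShapes (IsUnitarySite IsPeriodicSite)
open NE3CovariantWeitzenbock (covDiv)
open NE3RightInverseSupLetters (frameC supC corrC)
open NE3QbarIterCovLiftPrep (cruxC)
open NE3RightInverseSolveLetters (thetaLoc)
open NE3HatInvCurlLetters (curl1C)
open BlockAverageVaryDisc (rho0)
open NE3LinearisedAverageSup (curvSum)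
open NE7ApeCurvedRepRoadBBalabanScalarEnd (smallField_of_tanCritical_roadB_balaban_scalar_end)
open NE7SmoothRightInverseBmeanIterW (smoothRightInverse_letter_of_fluxGrad)
open NE3.LandauProjectionB8 (covDiv_gaugeDir_eq_covLapSite)
open NE3CovariantBlockMean (bmeanIterW)
open NE3.PairLandauB8 (avgKernelGauges)

open NE3.PairLandauB8 (IsLandauB8)

noncomputable section

variable {d : ℕ} {n : Type*} [Fintype n] [DecidableEq n]
set_option maxHeartbeats 400000 in
/-- **PACKAGE B's END ON (KL-B)[Gauge] + (T2)**: F171 `smallField_of_tanCritical_roadB_balaban_scalar_end` with (T1) SUPPLIED by F187 (`C_a`, `C_a′` named). [folklore] -/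
theorem smallField_of_tanCritical_roadB_balaban_scalar_T1_end [Nonempty n] (hd : 2 ≤ d) {L N : ℕ} [NeZero N] (hL : 2 ≤ L) (j : ℕ)
    -- the background
    {W : Site d → Fin d → (Matrix n n ℂ)ˣ} {x : ℝ} (hWu : IsUnitaryCfg W) (hWP : IsPeriodicCfg W ((N * L ^ (j + 1) : ℕ) : ℤ))
    (hx : 0 ≤ x) (hs : LevelSmall d L j x) (hWx : SmallField W x)
    -- the sup radius of the representative and the regime at `x′ = x + 4(e^{α₀} − 1)`
    {α₀ : ℝ} (hα0 : 0 ≤ α₀) (hs' : LevelSmall d L j (x + 4 * (Real.exp α₀ - 1)))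
    (hθ : cruxC d L * (((L : ℝ) ^ (j + 1)) ^ 2 * (x + 4 * (Real.exp α₀ - 1))) < 1)
    (hθl : thetaLoc d L * (((L : ℝ) ^ (j + 1)) ^ 2 * (x + 4 * (Real.exp α₀ - 1))) < 1)
    (hε : ((L : ℝ) ^ (j + 1)) ^ 2 * (x + 4 * (Real.exp α₀ - 1)) ≤ 1)
    -- the field: of the class, tangent-critical, over `W`'s datum
    {U : Site d → Fin d → (Matrix n n ℂ)ˣ} (hUu : IsUnitaryCfg U) (hUP : IsPeriodicCfg U ((N * L ^ (j + 1) : ℕ) : ℤ))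
    {xU : ℝ} (hxU : 0 ≤ xU) (hsU : LevelSmall d L j xU) (hUxU : SmallField U xU)
    (hcritU : ∀ Y : Site d → Fin d → Matrix n n ℂ, IsSkewDir Y → IsPeriodicDir Y ((N * L ^ (j + 1) : ℕ) : ℤ) →
      dirIter L (j + 1) U Y = 0 → dAction U Y (perWin d (N * L ^ (j + 1))) = 0)
    (hTopUW : cavgIter L (j + 1) U = cavgIter L (j + 1) W)
    -- row NE3's class data of `W` and E′'s initial gauge ∕ regime (as in `exists_landauRep_W`), the constant `c_RE` named; road (B)'s two extra regime lines
    -- the FLUX-GRADIENT radii of `W` and `U` (row NE3's `RegularSup` datum; (1.8)∕(1.9) TYPE via `NE3FluxGradientDictionary` ∕ `MinimalActionClassSix`)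
    {gW gU : ℝ} (hgW : ∀ (z : Site d) (μ : Fin d) (π : T4AveragingDeficitWall.Plane d), ‖T4AveragingDeficitWall.covGrad W (T4AveragingDeficitWall.flux W) z μ π‖ ≤ gW)
    (hgU : ∀ (z : Site d) (μ : Fin d) (π : T4AveragingDeficitWall.Plane d), ‖T4AveragingDeficitWall.covGrad U (T4AveragingDeficitWall.flux U) z μ π‖ ≤ gU)
    (hbx : 23040 * (d : ℝ) ^ 4 * (frameC d L + d) ^ 2 * ((L : ℝ) ^ (j + 1)) ^ 2 * x ≤ 1)
    (hcx : 11520 * (d : ℝ) ^ 4 * (frameC d L + d) ^ 3 * ((L : ℝ) ^ (j + 1)) ^ 3 * (2 * gW) ≤ 1)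
    (hbx' : 256 * (d : ℝ) ^ 2 * ((L : ℝ) ^ (j + 1)) ^ 2 * x ≤ 1) (hcx' : 16 * (d : ℝ) * ((L : ℝ) ^ (j + 1)) ^ 3 * (2 * gW) ≤ 1)
    {r₀ b₀ : ℝ} (hr₀ : ∀ (y : Site d) (μ : Fin d), ‖(((W y μ)⁻¹ * U y μ : (Matrix n n ℂ)ˣ) : (Matrix n n ℂ)) - 1‖ ≤ r₀)
    (hb₀ : ∀ x : Site d, ‖covDiv W (fun y μ => mlog (((W y μ)⁻¹ * U y μ : (Matrix n n ℂ)ˣ) : (Matrix n n ℂ))) x‖ ≤ b₀)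
    {cRE : ℝ} (hcRE : cRE = 1 + 2 * (Fintype.card n : ℝ) * (64 * (d : ℝ) ^ 2 * N) ^ d + 27 * (Fintype.card n : ℝ) ^ 3 * (512 : ℝ) ^ d * (N : ℝ) ^ d)
    (hreg₁ : (36 * (d : ℝ) * (frameC d L + d) ^ 2) * ((L : ℝ) ^ (j + 1)) ^ 2 * (cRE * b₀) ≤ 1 / 10)
    (hreg₂ : (36 * (d : ℝ) * (frameC d L + d)) * (L : ℝ) ^ (j + 1) * (cRE * b₀) ≤ 1 / 25)
    (hreg₃ : r₀ + 5 / 2 * ((36 * (d : ℝ) * (frameC d L + d)) * (L : ℝ) ^ (j + 1) * (cRE * b₀)) ≤ 1 / 20)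
    (hline : cRE * (4 * ((36 * (d : ℝ) * (frameC d L + d) ^ 2) * ((L : ℝ) ^ (j + 1)) ^ 2) * (b₀ + 4 * (cRE * b₀))
        + 25 * d * (r₀ + 5 / 2 * ((36 * (d : ℝ) * (frameC d L + d)) * (L : ℝ) ^ (j + 1) * (cRE * b₀))) * ((36 * (d : ℝ) * (frameC d L + d)) * (L : ℝ) ^ (j + 1))
        + 14 * d * ((36 * (d : ℝ) * (frameC d L + d)) * (L : ℝ) ^ (j + 1)) ^ 2 * (cRE * b₀)) ≤ 1 / 2)
    -- E′'s radii named: `α_E`, `θ_u`; the tent extension's `δ = corrC∕M·2θ_u`; road (B)'s regime `α_E ≤ 1∕40`, `θ_u ≤ 1∕160`, `δ ≤ 1∕40`, `α₀ ≥ α_E + δ + 4(2θ_u+δ)(α_E+δ)`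
    {αE θu : ℝ} (hαE : αE = 2 * (r₀ + 5 / 2 * ((36 * (d : ℝ) * (frameC d L + d)) * (L : ℝ) ^ (j + 1) * (cRE * b₀))))
    (hθu : θu = 4 * ((36 * (d : ℝ) * (frameC d L + d) ^ 2) * ((L : ℝ) ^ (j + 1)) ^ 2 * (cRE * b₀)))
    (hαE40 : αE ≤ 1 / 40) (hθu160 : θu ≤ 1 / 160)
    {δ : ℝ} (hδ : δ = corrC d / (L : ℝ) ^ (j + 1) * (2 * θu)) (hδ40 : δ ≤ 1 / 40) (hα₀ : αE + δ + 4 * (2 * θu + δ) * (αE + δ) ≤ α₀)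
    -- the remaining analytic letters at `W`: (L1)′ and α₁ for the SAME-TOP structured fields of radius `α₀`, (L2), (L3) discharged
    -- (L1)′ DISCHARGED (F111): the quadratic-remainder regime, the slice `S` containing the `W`-tangent skew periodic fields, and the names `c_N = 4m`, `ν = 24·#Plane·m`
    (hs1 : LevelSmall d L (j + 1) x) (hA : curvSum d L (j + 1) x ≤ 2 / 3 * L) (hσ0 : 4 * (3 + 12 * (d : ℝ)) ^ 2 * (L : ℝ) ^ (j + 1) * α₀ ≤ rho0 d L ^ 2)
    {cN aN ν : ℝ}
    (haN : aN = (supC d L / ((L : ℝ) ^ (j + 1) * (1 - cruxC d L * (((L : ℝ) ^ (j + 1)) ^ 2 * x)))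
        * (4 * (3 + 12 * (d : ℝ)) ^ 3 / rho0 d L ^ 2 * ((L : ℝ) ^ (j + 1) * α₀) ^ 2)))
    (hcN : cN = 4 * (supC d L / ((L : ℝ) ^ (j + 1) * (1 - cruxC d L * (((L : ℝ) ^ (j + 1)) ^ 2 * x)))
        * (4 * (3 + 12 * (d : ℝ)) ^ 3 / rho0 d L ^ 2 * ((L : ℝ) ^ (j + 1) * α₀) ^ 2)))
    (hνm : ν = 24 * (Fintype.card (T4AveragingDeficitWall.Plane d) : ℝ) * (supC d L / ((L : ℝ) ^ (j + 1) * (1 - cruxC d L * (((L : ℝ) ^ (j + 1)) ^ 2 * x)))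
        * (4 * (3 + 12 * (d : ℝ)) ^ 3 / rho0 d L ^ 2 * ((L : ℝ) ^ (j + 1) * α₀) ^ 2)))
    -- `x ≤ 1/4` (F141's regime; implied by `hbx'` when `d ≥ 2`, kept displayed for a one-line discharge)
    (hx4 : x ≤ 1 / 4)
    -- (KL-B): THE ONE-TERM LETTER ON BAŁABAN's STRAIGHT SLICE `ker QbarIter_W`, with an arbitrary gauge side condition `Gauge`
    (Gauge : (Site d → Fin d → Matrix n n ℂ) → Prop) {KB : ℝ}
    (hB : ∀ X'' : Site d → Fin d → Matrix n n ℂ, IsSkewDir X'' → IsPeriodicDir X'' ((N * L ^ (j + 1) : ℕ) : ℤ) → QbarIter L (j + 1) W X'' = 0 → Gauge X'' →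
      ∀ g'' : ℝ, 0 ≤ g'' →
      (∀ Y : Site d → Fin d → Matrix n n ℂ, IsSkewDir Y → IsPeriodicDir Y ((N * L ^ (j + 1) : ℕ) : ℤ) → QbarIter L (j + 1) W Y = 0 →
        |hess W X'' Y (perWin d (N * L ^ (j + 1)))| ≤ g'' * dirL1 Y (periodBox (d := d) (N * L ^ (j + 1)))) →
      ∀ z μ' ν', μ' ≠ ν' → ‖curlAt W X'' z μ' ν'‖ ≤ KB * g'')
    -- (T1): a SMOOTH exact right inverse of the nested transported block mean (prescribed block means; sup size `C_a`, covariant Laplacian `C_a′`)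
    {Ca Ca' Cb : ℝ}
    (hCa : Ca = 2 * (64 : ℝ) ^ d)
    (hCa' : Ca' = ((35 * (d : ℝ) / ((L : ℝ) ^ (j + 1)) ^ 2 + 2 * (2 * (d : ℝ) ^ 2 * ((L : ℝ) ^ (j + 1) - 1) * (2 * gW) + 8 * (d : ℝ) ^ 3 * ((L : ℝ) ^ (j + 1) - 1) ^ 2 * x ^ 2) + 4 * (d : ℝ) * (((d : ℝ) - 1) * ((L : ℝ) ^ (j + 1) - 1) * x) ^ 2 + 8 * (d : ℝ) * (((d : ℝ) - 1) * ((L : ℝ) ^ (j + 1) - 1) * x) / (L : ℝ) ^ (j + 1)) * (2 * (64 : ℝ) ^ d)))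
    -- (T2): the BLOCK-LANDAU CORRECTION on Bałaban's straight slice by a block-mean-zero gauge (`avgKernelGauges`), sup size `C_b` against the covariant divergence
    (hT2 : ∀ X' : Site d → Fin d → Matrix n n ℂ, IsSkewDir X' → IsPeriodicDir X' ((N * L ^ (j + 1) : ℕ) : ℤ) → QbarIter L (j + 1) W X' = 0 →
      ∀ D' : ℝ, (∀ y, ‖covDiv W X' y‖ ≤ D') →
      ∃ lb ∈ avgKernelGauges (d := d) (n := n) L N (j + 1) W,
        Gauge (fun y κ => X' y κ + gaugeDir W lb y κ) ∧ ∀ y, ‖lb y‖ ≤ Cb * D')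
    (hcritW : ∀ Y : Site d → Fin d → Matrix n n ℂ, IsSkewDir Y → IsPeriodicDir Y ((N * L ^ (j + 1) : ℕ) : ℤ) → dirIter L (j + 1) W Y = 0 →
      dAction W Y (perWin d (N * L ^ (j + 1))) = 0) :
    SmallField U (x + ((KB * (1 + 2 * d * (2 * ((d : ℝ) * L) * Real.exp (((L : ℝ) ^ d / L) * ((d : ℝ) * (16 * ((d : ℝ) + 1) * ((d : ℝ) + 4) * (L : ℝ) ^ 2) * (1250 * ((nbRad d L : ℝ) + L) + 8 * ((d : ℝ) * L) + 2 * L)) * (2 / twoLevelSmall d L))))) * (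
        ((x + 4 * (Real.exp α₀ - 1))
            * ((curl1C d L / (1 - thetaLoc d L * (((L : ℝ) ^ (j + 1)) ^ 2 * (x + 4 * (Real.exp α₀ - 1)))))
                * (((L : ℝ) ^ (j + 1)) ^ d / ((L : ℝ) ^ (j + 1)) ^ 2))
            * (Real.exp (((L : ℝ) ^ d / L) * ((d : ℝ) * (16 * ((d : ℝ) + 1) * ((d : ℝ) + 4) * (L : ℝ) ^ 2)
                  * (1250 * ((nbRad d L : ℝ) + L) + 8 * ((d : ℝ) * L) + 2 * L)) * (2 / twoLevelSmall d L))
                * ((L : ℝ) / (L : ℝ) ^ d) ^ j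
                * (((d : ℝ) * (2 * nbRad d L + 1) ^ d) * ((2 * (d : ℝ) + 4) * (L : ℝ) ^ 2) * (2 * (L : ℝ) ^ j) * (Real.exp α₀ - 1)
                  + (17 / 8 * ((L : ℝ) ^ 2) ^ j * (x + 4 * (Real.exp α₀ - 1)))
                    * (((d : ℝ) * (2 * nbRad d L + 1) ^ d) * ((2 * (d : ℝ) + 4)
                          * (2 * (2 * L * (nbRad d L : ℝ) + 128 * ((d : ℝ) + 1) * ((d : ℝ) + 4) * (L : ℝ) ^ 2)))
                      + ((d : ℝ) * (2 * nbRad d L + 1) ^ d) * ((2 * (d : ℝ) + 4) * (L : ℝ) ^ 2 * (2 * (nbRad d L : ℝ))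
                          + 2 * (8 * (L : ℝ) + (1250 * ((nbRad d L : ℝ) + L) + 8 * (d * L) + 2 * L))
                              * (16 * ((d : ℝ) + 1) * ((d : ℝ) + 4) * (L : ℝ) ^ 2))))))
        + (Fintype.card (T4AveragingDeficitWall.Plane d) : ℝ)
          * (2 * (240 * (Real.exp α₀ - 1) * α₀ * (2 * ((4 * ((d : ℝ) * αE / ((L ^ (j + 1) : ℕ) : ℝ) + ((L ^ (j + 1) : ℕ) : ℝ) * ((((d : ℝ) - 1) * (2 * gU) + ((d : ℝ) - 1) * (2 * gW) + d * (2 * (Real.exp αE - 1) * xU + 2 * (xU * x) + 2 * (x * (2 + x) * x) + 2 * (xU * (2 + xU) * xU))) + 2 * (b₀ + 3 * (cRE * b₀)))) + (4 * ((L ^ (j + 1) : ℕ) : ℝ) * (8 * d * (Real.exp (4 * αE) - 1) * x + 10 * d * x + 2 * (2 * (d : ℝ) ^ 2 * (((L ^ (j + 1) : ℕ) : ℝ) + 1) * (2 * gW) + 8 * (d : ℝ) ^ 3 * (((L ^ (j + 1) : ℕ) : ℝ) + 1) ^ 2 * x ^ 2) + 12 * d * (2 * (d : ℝ) * (((L ^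 (j + 1) : ℕ) : ℝ) + 1) * x) ^ 2) + 4 * (2 * (d : ℝ) * (((L ^ (j + 1) : ℕ) : ℝ) + 1) * x)) * αE + 2 * x * αE) + 2 * δ + 2 * (4 * (2 * θu + δ) * (αE + δ))) + 24 * α₀ * (Real.exp α₀ - 1) + x) + 8 * α₀ * (2 * ((4 * ((d : ℝ) * αE / ((L ^ (j + 1) : ℕ) : ℝ) + ((L ^ (j + 1) : ℕ) : ℝ) * ((((d : ℝ) - 1) * (2 * gU) + ((d : ℝ) - 1) * (2 * gW) + d * (2 * (Real.exp αE - 1) * xU + 2 * (xU * x) + 2 * (x * (2 + x) * x) + 2 * (xU * (2 + xU) * xU))) + 2 * (b₀ + 3 * (cRE * b₀)))) + (4 * ((L ^ (j + 1) : ℕ) : ℝ) * (8 * d * (Real.exp (4 * αE) - 1) * x + 10 * d * x + 2 * (2 * (d : ℝ) ^ 2 * (((L ^ (j + 1) : ℕ) : ℝ) + 1) * (2 * gW) + 8 * (d : ℝ) ^ 3 * (((L ^ (j + 1) : ℕ) : ℝ) + 1) ^ 2 * x ^ 2) + 12 * d * (2 * (d : ℝ) * (((L ^ (j + 1) : ℕ)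 : ℝ) + 1) * x) ^ 2) + 4 * (2 * (d : ℝ) * (((L ^ (j + 1) : ℕ) : ℝ) + 1) * x)) * αE + 2 * x * αE) + 2 * δ + 2 * (4 * (2 * θu + δ) * (αE + δ))) + 24 * α₀ * (Real.exp α₀ - 1))
              + 6 * (Real.exp α₀ - 1) * (2 * ((4 * ((d : ℝ) * αE / ((L ^ (j + 1) : ℕ) : ℝ) + ((L ^ (j + 1) : ℕ) : ℝ) * ((((d : ℝ) - 1) * (2 * gU) + ((d : ℝ) - 1) * (2 * gW) + d * (2 * (Real.exp αE - 1) * xU + 2 * (xU * x) + 2 * (x * (2 + x) * x) + 2 * (xU * (2 + xU) * xU))) + 2 * (b₀ + 3 * (cRE * b₀)))) + (4 * ((L ^ (j + 1) : ℕ) : ℝ) * (8 * d * (Real.exp (4 * αE) - 1) * x + 10 * d * x + 2 * (2 * (d : ℝ) ^ 2 * (((L ^ (j + 1) : ℕ) : ℝ) + 1) * (2 * gW) + 8 * (d : ℝ) ^ 3 * (((L ^ (j + 1) : ℕ) : ℝ) + 1) ^ 2 * x ^ 2) + 12 * d * (2 * (d : ℝ) * (((L ^ (j + 1) : ℕ)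 : ℝ) + 1) * x) ^ 2) + 4 * (2 * (d : ℝ) * (((L ^ (j + 1) : ℕ) : ℝ) + 1) * x)) * αE + 2 * x * αE) + 2 * δ + 2 * (4 * (2 * θu + δ) * (αE + δ))) + 24 * (Real.exp α₀ - 1) * α₀)
              + (2 * ((4 * ((d : ℝ) * αE / ((L ^ (j + 1) : ℕ) : ℝ) + ((L ^ (j + 1) : ℕ) : ℝ) * ((((d : ℝ) - 1) * (2 * gU) + ((d : ℝ) - 1) * (2 * gW) + d * (2 * (Real.exp αE - 1) * xU + 2 * (xU * x) + 2 * (x * (2 + x) * x) + 2 * (xU * (2 + xU) * xU))) + 2 * (b₀ + 3 * (cRE * b₀)))) + (4 * ((L ^ (j + 1) : ℕ) : ℝ) * (8 * d * (Real.exp (4 * αE) - 1) * x + 10 * d * x + 2 * (2 * (d : ℝ) ^ 2 * (((L ^ (j + 1) : ℕ) : ℝ) + 1) * (2 * gW) + 8 * (d : ℝ) ^ 3 * (((L ^ (j + 1) : ℕ) : ℝ) + 1) ^ 2 * x ^ 2) + 12 * d * (2 * (d : ℝ) * (((L ^ (j + 1) : ℕ) : ℝ) + 1) * x) ^ 2)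 + 4 * (2 * (d : ℝ) * (((L ^ (j + 1) : ℕ) : ℝ) + 1) * x)) * αE + 2 * x * αE) + 2 * δ + 2 * (4 * (2 * θu + δ) * (αE + δ))) + 24 * (Real.exp α₀ - 1) * α₀) * (2 * ((4 * ((d : ℝ) * αE / ((L ^ (j + 1) : ℕ) : ℝ) + ((L ^ (j + 1) : ℕ) : ℝ) * ((((d : ℝ) - 1) * (2 * gU) + ((d : ℝ) - 1) * (2 * gW) + d * (2 * (Real.exp αE - 1) * xU + 2 * (xU * x) + 2 * (x * (2 + x) * x) + 2 * (xU * (2 + xU) * xU))) + 2 * (b₀ + 3 * (cRE * b₀)))) + (4 * ((L ^ (j + 1) : ℕ) : ℝ) * (8 * d * (Real.exp (4 * αE) - 1) * x + 10 * d * x + 2 * (2 * (d : ℝ) ^ 2 * (((L ^ (j + 1) : ℕ) : ℝ) + 1) * (2 * gW) + 8 * (d : ℝ) ^ 3 * (((L ^ (j + 1) : ℕ) : ℝ) + 1) ^ 2 * x ^ 2) + 12 * d * (2 * (d : ℝ) * (((L ^ (j + 1) : ℕ) : ℝ) + 1) * x) ^ 2) + 4 * (2 * (d : ℝ) * (((L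 ^ (j + 1) : ℕ) : ℝ) + 1) * x)) * αE + 2 * x * αE) + 2 * δ + 2 * (4 * (2 * θu + δ) * (αE + δ))) + 24 * α₀ * (Real.exp α₀ - 1))
              + 960 * (Real.exp α₀ - 1) * α₀ ^ 2 + 32 * x * α₀ ^ 2)
            + (64 * α₀ * ((4 * ((d : ℝ) * αE / ((L ^ (j + 1) : ℕ) : ℝ) + ((L ^ (j + 1) : ℕ) : ℝ) * ((((d : ℝ) - 1) * (2 * gU) + ((d : ℝ) - 1) * (2 * gW) + d * (2 * (Real.exp αE - 1) * xU + 2 * (xU * x) + 2 * (x * (2 + x) * x) + 2 * (xU * (2 + xU) * xU))) + 2 * (b₀ + 3 * (cRE * b₀)))) + (4 * ((L ^ (j + 1) : ℕ) : ℝ) * (8 * d * (Real.exp (4 * αE) - 1) * x + 10 * d * x + 2 * (2 * (d : ℝ) ^ 2 * (((L ^ (j + 1) : ℕ) : ℝ) + 1) * (2 * gW) + 8 * (d : ℝ) ^ 3 * (((L ^ (j + 1) : ℕ) : ℝ) + 1) ^ 2 * x ^ 2) + 12 * d * (2 * (d : ℝ) * (((L ^ (j + 1) : ℕ) : ℝ)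 + 1) * x) ^ 2) + 4 * (2 * (d : ℝ) * (((L ^ (j + 1) : ℕ) : ℝ) + 1) * x)) * αE + 2 * x * αE) + 2 * δ + 2 * (4 * (2 * θu + δ) * (αE + δ))) + 1024 * x * α₀ ^ 2))
        + ν) + (2 * d * KB * (2 * ((d : ℝ) * L) * Real.exp (((L : ℝ) ^ d / L) * ((d : ℝ) * (16 * ((d : ℝ) + 1) * ((d : ℝ) + 4) * (L : ℝ) ^ 2) * (1250 * ((nbRad d L : ℝ) + L) + 8 * ((d : ℝ) * L) + 2 * L)) * (2 / twoLevelSmall d L))) * ((d : ℝ) * gW + 12 * (Fintype.card (T4AveragingDeficitWall.Plane d) : ℝ) * x ^ 2)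
              + (2 * KB * ((d : ℝ) * gW + 12 * (Fintype.card (T4AveragingDeficitWall.Plane d) : ℝ) * x ^ 2) * (1 + 4 * d * (2 * ((d : ℝ) * L) * Real.exp (((L : ℝ) ^ d / L) * ((d : ℝ) * (16 * ((d : ℝ) + 1) * ((d : ℝ) + 4) * (L : ℝ) ^ 2) * (1250 * ((nbRad d L : ℝ) + L) + 8 * ((d : ℝ) * L) + 2 * L)) * (2 / twoLevelSmall d L)))) + 2 * x) * ((Ca + Cb * Ca') * (6 * (d : ℝ) * (L : ℝ) ^ (j + 1)))) * (α₀ + aN)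
        + ((2 * KB * ((d : ℝ) * gW + 12 * (Fintype.card (T4AveragingDeficitWall.Plane d) : ℝ) * x ^ 2) * (1 + 4 * d * (2 * ((d : ℝ) * L) * Real.exp (((L : ℝ) ^ d / L) * ((d : ℝ) * (16 * ((d : ℝ) + 1) * ((d : ℝ) + 4) * (L : ℝ) ^ 2) * (1250 * ((nbRad d L : ℝ) + L) + 8 * ((d : ℝ) * L) + 2 * L)) * (2 / twoLevelSmall d L)))) + 2 * x) * Cb) * (2 * (d : ℝ) * (4 * (2 * θu + δ) * (αE + δ)) + (b₀ + 3 * (cRE * b₀)) + 2 * (d : ℝ) * aN) 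
        + ((2 * KB * ((d : ℝ) * gW + 12 * (Fintype.card (T4AveragingDeficitWall.Plane d) : ℝ) * x ^ 2) * (1 + 4 * d * (2 * ((d : ℝ) * L) * Real.exp (((L : ℝ) ^ d / L) * ((d : ℝ) * (16 * ((d : ℝ) + 1) * ((d : ℝ) + 4) * (L : ℝ) ^ 2) * (1250 * ((nbRad d L : ℝ) + L) + 8 * ((d : ℝ) * L) + 2 * L)) * (2 / twoLevelSmall d L)))) + 2 * x) * (1 + Ca + Cb * Ca')) * (2 * θu) + cN + 28 * α₀ ^ 2)) := by
  have hgW0 : 0 ≤ gW :=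
    (norm_nonneg _).trans (hgW 0 ⟨0, by omega⟩ ⟨(⟨0, by omega⟩, ⟨1, by omega⟩), Fin.mk_lt_mk.mpr zero_lt_one⟩)
  have hT := smoothRightInverse_letter_of_fluxGrad (N := N) (by omega) hL j hWu hWP hx hx4 hs hWx hgW0 hgW
  rw [← hCa'] at hT
  rw [← hCa] at hT
  have hT1 : ∀ θ' : Site d → Matrix n n ℂ, (∀ z, θ' z ∈ skewAdjoint (Matrix n n ℂ)) → (∀ (z : Site d) (i : Fin d), θ' (z + (N : ℤ) • e i) = θ' z) →
      ∀ s : ℝ, (∀ z, ‖θ' z‖ ≤ s) →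
      ∃ la : Site d → Matrix n n ℂ, (∀ y, la y ∈ skewAdjoint (Matrix n n ℂ)) ∧
        (∀ (y : Site d) (i : Fin d), la (y + ((N * L ^ (j + 1) : ℕ) : ℤ) • e i) = la y) ∧
        bmeanIterW L (j + 1) W la = θ' ∧ (∀ y, ‖la y‖ ≤ Ca * s) ∧ (∀ y, ‖covDiv W (gaugeDir W la) y‖ ≤ Ca' * s) := by
    intro θ' hθs hθP s hθb
    obtain ⟨h₀, h1, h2, h3, h4, h5⟩ := hT θ' hθs hθP s hθb
    exact ⟨h₀, h1, h2, h3, h4, fun y => by rw [covDiv_gaugeDir_eq_covLapSite]; exact h5 y⟩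
  exact smallField_of_tanCritical_roadB_balaban_scalar_end hd hL j hWu hWP hx hs hWx hα0 hs' hθ hθl hε hUu hUP hxU hsU hUxU hcritU hTopUW hgW hgU hbx hcx hbx' hcx'
    hr₀ hb₀ hcRE hreg₁ hreg₂ hreg₃ hline hαE hθu hαE40 hθu160 hδ hδ40 hα₀ hs1 hA hσ0 haN hcN hνm hx4 Gauge hB hT1 hT2 hcritW

end

end Summit.QuantumFields.BalabanUV.T4Continuum.NE7ApeCurvedRepRoadBBalabanScalarT1End
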